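import Summits.AtomisticToContinuum.Crystallization.Theorems.FreeSplittingCertificatesRadiusLadderHarmonics

/-!
# `FiniteRangeSplitting` (stmt-AtomisticToContinuum-12559): Delsarte's linear-programming bound for spherical codes, degree `≤ 5`

Support file for crux r2 of route `FreeSplittingCertificates` (block-2b unit `b2b-freesplit-A`, gen 13).
VALUE = a measure-free counting tool (kernel-checked algebra) used by `…RadiusLadderShellCount` /
`…RadiusLadderHalfRule54` to lower the certified hard-core threshold of the half rule from `4/3` to `5/4` —
NOT summit progress.

The volume packing bound of `…RadiusLadderPacking` allows `26` touching neighbours where the kissing number is `12`;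
this file supplies the classical remedy WITHOUT any measure theory, on top of the positive-definiteness facts
`sum_sum_legPk_nonneg` (`k = 1…5`) of `…RadiusLadderHarmonics`:

* `card_mul_le_of_delsarte` — DELSARTE'S BOUND [Delsarte–Goethals–Seidel 1977; Kabatiansky–Levenshtein 1978;
  Conway–Sloane ch. 9/13]: if `F = f₀ + Σ_{k=1}^{5} f_k P_k` with `f_k ≥ 0`, and `F(t) ≤ 0` on the pairwise inner
  products of the unit vectors `u_i` (`i ∈ s`), then `|s|·f₀ ≤ F(1)`.
* `card_mul_le_of_inner_le` / `card_le_of_inner_le` — the product form used downstream: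
  `F(t) = (t − c)(t − a)²(t − b)²` is `≤ 0` for `t ≤ c` automatically, so a code with pairwise `⟪u_i,u_j⟫ ≤ c` has
  `|s|·f₀ ≤ (1 − c)(1 − a)²(1 − b)²` as soon as the Legendre coefficients of `F` (explicit polynomials in `c a b`,
  `prodForm_eq_legendre`) have the right signs — for each numerical `(c, a, b)` a `norm_num` fact.
* THE MENU: `card_le_13_of_inner_le_half` (`c = 1/2`: at most `13` — Delsarte's LP value; the kissing number is `12`)
  and, for the thin shells `[5/4, t]`, `t = (26 + k)/20`, `k = 0…8`, of the layer cake of `…RadiusLadderHalfRule54`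
  (`c = 1 − 625/(2(26+k)²)`): `card_le_14_of_inner_le`, `…15…`, `…17…`, `…19…`, `…21…`, `…25…`, `…29…`, `…36…`,
  `…46…` (the double roots `a, b` are rational roundings of the LP-optimal ones; certificates found by
  `run/shared/lean/b2b/freesplit-r2/code/gen13_delsarte/delsarte_cert.py`, exact over `ℚ`).
-/

noncomputable section

namespace Summit.AtomisticToContinuum.Crystallization.Theorems.StrictSplittingRuleBirth

open scoped BigOperators

/-! ## Delsarte's linear-programming bound (degree `≤ 5`) -/

/-- **Delsarte's bound.**  Let `F = f₀ + Σ_{k=1}^5 f_k P_k` with `f₁,…,f₅ ≥ 0`, and let `u` be unit vectors on which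
`F(⟪u_i,u_j⟫) ≤ 0` for `i ≠ j` (within `s`).  Then `|s|·f₀ ≤ F(1)`.  (For `s = ∅` this needs `0 ≤ F(1)`, assumed.)
Proof: `|s|²f₀ ≤ Σ_{i,j∈s} F(⟪u_i,u_j⟫) ≤ |s|·F(1)` — the first by positive definiteness of `P₁…P₅`, the second
because only the diagonal is positive. -/
theorem card_mul_le_of_delsarte {ι : Type*} (s : Finset ι) (u : ι → EuclideanSpace ℝ (Fin 3)) (hu : ∀ i ∈ s, ‖u i‖ = 1) (F : ℝ → ℝ)
    (f0 f1 f2 f3 f4 f5 : ℝ)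
    (hF : ∀ t, F t = f0 + f1 * legP1 t + f2 * legP2 t + f3 * legP3 t + f4 * legP4 t + f5 * legP5 t)
    (h1 : 0 ≤ f1) (h2 : 0 ≤ f2) (h3 : 0 ≤ f3) (h4 : 0 ≤ f4) (h5 : 0 ≤ f5) (hF1 : 0 ≤ F 1)
    (hneg : ∀ i ∈ s, ∀ j ∈ s, i ≠ j → F (inner ℝ (u i) (u j)) ≤ 0) :
    (s.card : ℝ) * f0 ≤ F 1 := by
  classical
  -- the double sum is at most `|s|·F(1)` (off-diagonal terms are `≤ 0`)
  have upper : ∑ i ∈ s, ∑ j ∈ s, F (inner ℝ (u i) (u j)) ≤ (s.card : ℝ) * F 1 := by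
    have hrow : ∀ i ∈ s, ∑ j ∈ s, F (inner ℝ (u i) (u j)) ≤ F 1 := fun i hi => by
      rw [← Finset.add_sum_erase s _ hi, inner_self_eq_one_of_norm (hu i hi)]
      have : ∑ j ∈ s.erase i, F (inner ℝ (u i) (u j)) ≤ 0 :=
        Finset.sum_nonpos fun j hj => hneg i hi j (Finset.mem_of_mem_erase hj) (Finset.ne_of_mem_erase hj).symm
      linarith
    calc ∑ i ∈ s, ∑ j ∈ s, F (inner ℝ (u i) (u j)) ≤ ∑ i ∈ s, F 1 := Finset.sum_le_sum hrow
      _ = (s.card : ℝ) * F 1 := by rw [Finset.sum_const, nsmul_eq_mul]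
  -- and at least `|s|²·f₀` (positive definiteness)
  have lower : (s.card : ℝ) ^ 2 * f0 ≤ ∑ i ∈ s, ∑ j ∈ s, F (inner ℝ (u i) (u j)) := by
    have e : ∑ i ∈ s, ∑ j ∈ s, F (inner ℝ (u i) (u j)) =
        (s.card : ℝ) ^ 2 * f0 + f1 * ∑ i ∈ s, ∑ j ∈ s, legP1 (inner ℝ (u i) (u j))
          + f2 * ∑ i ∈ s, ∑ j ∈ s, legP2 (inner ℝ (u i) (u j)) + f3 * ∑ i ∈ s, ∑ j ∈ s, legP3 (inner ℝ (u i) (u j))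
          + f4 * ∑ i ∈ s, ∑ j ∈ s, legP4 (inner ℝ (u i) (u j)) + f5 * ∑ i ∈ s, ∑ j ∈ s, legP5 (inner ℝ (u i) (u j)) := by
      simp only [hF, Finset.sum_add_distrib, ← Finset.mul_sum, Finset.sum_const, nsmul_eq_mul]
      ring
    rw [e]
    have p1 := mul_nonneg h1 (sum_sum_legP1_nonneg s u hu)
    have p2 := mul_nonneg h2 (sum_sum_legP2_nonneg s u hu)
    have p3 := mul_nonneg h3 (sum_sum_legP3_nonneg s u hu)
    have p4 := mul_nonneg h4 (sum_sum_legP4_nonneg s u hu)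
    have p5 := mul_nonneg h5 (sum_sum_legP5_nonneg s u hu)
    linarith
  rcases Nat.eq_zero_or_pos s.card with h0 | hpos
  · rw [h0, Nat.cast_zero, zero_mul]
    exact hF1
  · have hc : (0 : ℝ) < s.card := by exact_mod_cast hpos
    by_contra h
    rw [not_le] at h
    nlinarith [mul_lt_mul_of_pos_left h hc]

/-! ## The product form `F(t) = (t − c)(t − a)²(t − b)²` -/

/-- The Legendre expansion of the product form. -/
theorem prodForm_eq_legendre (c a b t : ℝ) :
    (t - c) * (t - a) ^ 2 * (t - b) ^ 2 =
      (-c * a ^ 2 * b ^ 2 - (1 / 3 : ℝ) * c * a ^ 2 - (4 / 3 : ℝ) * c * a * b - (1 / 3 : ℝ) * c * b ^ 2 - (1 / 5 : ℝ) * c - (2 / 3 : ℝ) * a ^ 2 * b - (2 / 3 : ℝ) * a * b ^ 2 - (2 / 5 : ℝ) * a - (2 / 5 : ℝ) * b) + ((2 : ℝ) * c * a ^ 2 * b + (2 : ℝ) * c * a * b ^ 2 + (6 / 5 : ℝ) * c * a + (6 / 5 : ℝ) * c * b + a ^ 2 * b ^ 2 + (3 / 5 : ℝ) * a ^ 2 +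 (12 / 5 : ℝ) * a * b + (3 / 5 : ℝ) * b ^ 2 + (3 / 7 : ℝ)) * legP1 t + (-(2 / 3 : ℝ) * c * a ^ 2 - (8 / 3 : ℝ) * c * a * b - (2 / 3 : ℝ) * c * b ^ 2 - (4 / 7 : ℝ) * c - (4 / 3 : ℝ) * a ^ 2 * b - (4 / 3 : ℝ) * a * b ^ 2 - (8 / 7 : ℝ) * a - (8 / 7 : ℝ) * b) * legP2 t + ((4 / 5 : ℝ) * c * a + (4 / 5 : ℝ) * c * b + (2 / 5 : ℝ) * a ^ 2 + (8 / 5 : ℝ) * a * b + (2 / 5 : ℝ) * b ^ 2 + (4 / 9 : ℝ)) * legP3 t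
        + (-(8 / 35 : ℝ) * c - (16 / 35 : ℝ) * a - (16 / 35 : ℝ) * b) * legP4 t + ((8 / 63 : ℝ)) * legP5 t := by
  simp only [legP1, legP2, legP3, legP4, legP5]
  ring

/-- The product form is nonpositive up to `c`. -/
theorem prodForm_nonpos {c a b t : ℝ} (ht : t ≤ c) : (t - c) * (t - a) ^ 2 * (t - b) ^ 2 ≤ 0 := by
  have : 0 ≤ (t - a) ^ 2 * (t - b) ^ 2 := by positivity
  nlinarith

/-- **Delsarte's bound, product form**: unit vectors with pairwise `⟪u_i,u_j⟫ ≤ c ≤ 1` number at most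
`(1 − c)(1 − a)²(1 − b)² / f₀(c,a,b)` whenever the five higher Legendre coefficients `f₁ … f₅` of the product form
(the explicit polynomials in `c a b` of `prodForm_eq_legendre`) are `≥ 0`. -/
theorem card_mul_le_of_inner_le {ι : Type*} (s : Finset ι) (u : ι → EuclideanSpace ℝ (Fin 3)) (hu : ∀ i ∈ s, ‖u i‖ = 1) {c a b : ℝ}
    (hc1 : c ≤ 1) (h1 : 0 ≤ ((2 : ℝ) * c * a ^ 2 * b + (2 : ℝ) * c * a * b ^ 2 + (6 / 5 : ℝ) * c * a + (6 / 5 : ℝ) * c * b + a ^ 2 * b ^ 2 + (3 / 5 : ℝ) * a ^ 2 + (12 / 5 : ℝ) * a * b + (3 / 5 : ℝ) * b ^ 2 + (3 / 7 : ℝ))) (h2 : 0 ≤ (-(2 / 3 : ℝ) * c * a ^ 2 - (8 / 3 : ℝ) * c * a * b - (2 / 3 : ℝ) * c * b ^ 2 - (4 / 7 : ℝ) * c - (4 / 3 : ℝ) * a ^ 2 * b - (4 / 3 : ℝ) * a * b ^ 2 - (8 / 7 : ℝ) * a - (8 / 7 : ℝ) * b)) (h3 : 0 ≤ ((4 / 5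 : ℝ) * c * a + (4 / 5 : ℝ) * c * b + (2 / 5 : ℝ) * a ^ 2 + (8 / 5 : ℝ) * a * b + (2 / 5 : ℝ) * b ^ 2 + (4 / 9 : ℝ)))
    (h4 : 0 ≤ (-(8 / 35 : ℝ) * c - (16 / 35 : ℝ) * a - (16 / 35 : ℝ) * b)) (h5 : 0 ≤ ((8 / 63 : ℝ)))
    (hinner : ∀ i ∈ s, ∀ j ∈ s, i ≠ j → inner ℝ (u i) (u j) ≤ c) :
    (s.card : ℝ) * (-c * a ^ 2 * b ^ 2 - (1 / 3 : ℝ) * c * a ^ 2 - (4 / 3 : ℝ) * c * a * b - (1 / 3 : ℝ) * c * b ^ 2 - (1 / 5 : ℝ) * c - (2 / 3 : ℝ) * a ^ 2 * b - (2 / 3 : ℝ) * a * b ^ 2 - (2 / 5 : ℝ) * a - (2 / 5 : ℝ) * b) ≤ (1 - c) * (1 - a) ^ 2 * (1 - b) ^ 2 := by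
  have h := card_mul_le_of_delsarte s u hu (fun t => (t - c) * (t - a) ^ 2 * (t - b) ^ 2) _ _ _ _ _ _
    (prodForm_eq_legendre c a b) h1 h2 h3 h4 h5
    (by have : 0 ≤ (1 - a) ^ 2 * (1 - b) ^ 2 := by positivity
        show 0 ≤ (1 - c) * (1 - a) ^ 2 * (1 - b) ^ 2
        nlinarith)
    (fun i hi j hj hij => prodForm_nonpos (hinner i hi j hj hij))
  exact h

/-- … and the integer count: if moreover `(1 − c)(1 − a)²(1 − b)² < (D + 1)·f₀(c,a,b)` (which forces `f₀ > 0`),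
then `|s| ≤ D`. -/
theorem card_le_of_inner_le {ι : Type*} (s : Finset ι) (u : ι → EuclideanSpace ℝ (Fin 3)) (hu : ∀ i ∈ s, ‖u i‖ = 1) {c a b : ℝ}
    (hc1 : c ≤ 1) (h1 : 0 ≤ ((2 : ℝ) * c * a ^ 2 * b + (2 : ℝ) * c * a * b ^ 2 + (6 / 5 : ℝ) * c * a + (6 / 5 : ℝ) * c * b + a ^ 2 * b ^ 2 + (3 / 5 : ℝ) * a ^ 2 + (12 / 5 : ℝ) * a * b + (3 / 5 : ℝ) * b ^ 2 + (3 / 7 : ℝ))) (h2 : 0 ≤ (-(2 / 3 : ℝ) * c * a ^ 2 - (8 / 3 : ℝ) * c * a * b - (2 / 3 : ℝ) * c * b ^ 2 - (4 / 7 : ℝ) * c - (4 / 3 : ℝ) * a ^ 2 * b - (4 / 3 : ℝ) * a * b ^ 2 - (8 / 7 : ℝ) * a - (8 / 7 : ℝ) * b)) (h3 : 0 ≤ ((4 / 5 : ℝ) * c * a + (4 / 5 : ℝ) * c * b + (2 / 5 : ℝ) * a ^ 2 + (8 / 5 : ℝ) * a * b + (2 / 5 : ℝ) * b ^ 2 +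 (4 / 9 : ℝ)))
    (h4 : 0 ≤ (-(8 / 35 : ℝ) * c - (16 / 35 : ℝ) * a - (16 / 35 : ℝ) * b)) (h5 : 0 ≤ ((8 / 63 : ℝ)))
    (hinner : ∀ i ∈ s, ∀ j ∈ s, i ≠ j → inner ℝ (u i) (u j) ≤ c) (D : ℕ)
    (hD : (1 - c) * (1 - a) ^ 2 * (1 - b) ^ 2 < (D + 1) * (-c * a ^ 2 * b ^ 2 - (1 / 3 : ℝ) * c * a ^ 2 - (4 / 3 : ℝ) * c * a * b - (1 / 3 : ℝ) * c * b ^ 2 - (1 / 5 : ℝ) * c - (2 / 3 : ℝ) * a ^ 2 * b - (2 / 3 : ℝ) * a * b ^ 2 - (2 / 5 : ℝ) * a - (2 / 5 : ℝ) * b)) : s.card ≤ D := by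
  have h := card_mul_le_of_inner_le s u hu hc1 h1 h2 h3 h4 h5 hinner
  have h0 : 0 < (-c * a ^ 2 * b ^ 2 - (1 / 3 : ℝ) * c * a ^ 2 - (4 / 3 : ℝ) * c * a * b - (1 / 3 : ℝ) * c * b ^ 2 - (1 / 5 : ℝ) * c - (2 / 3 : ℝ) * a ^ 2 * b - (2 / 3 : ℝ) * a * b ^ 2 - (2 / 5 : ℝ) * a - (2 / 5 : ℝ) * b) := by
    by_contra hle
    rw [not_lt] at hle
    have : 0 ≤ (1 - a) ^ 2 * (1 - b) ^ 2 := by positivity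
    have hF1 : 0 ≤ (1 - c) * (1 - a) ^ 2 * (1 - b) ^ 2 := by nlinarith
    have : ((D : ℝ) + 1) * (-c * a ^ 2 * b ^ 2 - (1 / 3 : ℝ) * c * a ^ 2 - (4 / 3 : ℝ) * c * a * b - (1 / 3 : ℝ) * c * b ^ 2 - (1 / 5 : ℝ) * c - (2 / 3 : ℝ) * a ^ 2 * b - (2 / 3 : ℝ) * a * b ^ 2 - (2 / 5 : ℝ) * a - (2 / 5 : ℝ) * b) ≤ 0 := mul_nonpos_of_nonneg_of_nonpos (by positivity) hle
    linarith
  have hlt : (s.card : ℝ) < D + 1 := by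
    by_contra hge
    rw [not_lt] at hge
    have := mul_le_mul_of_nonneg_right hge h0.le
    linarith
  exact_mod_cast Nat.lt_succ_iff.mp (by exact_mod_cast hlt : s.card < D + 1)

/-! ## The menu: one `norm_num` fact per threshold -/

/-- `c = 1/2` (angle `≥ 60°`): at most `13` (Delsarte's LP value at degree `5`; the kissing number is `12`). -/
theorem card_le_13_of_inner_le_half {ι : Type*} (s : Finset ι) (u : ι → EuclideanSpace ℝ (Fin 3)) (hu : ∀ i ∈ s, ‖u i‖ = 1)
    (hinner : ∀ i ∈ s, ∀ j ∈ s, i ≠ j → inner ℝ (u i) (u j) ≤ (1 / 2)) : s.card ≤ 13 :=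
  card_le_of_inner_le s u hu (c := (1 / 2)) (a := (-2207 / 2500)) (b := (-793 / 2500)) (by norm_num)
    (by norm_num) (by norm_num) (by norm_num) (by norm_num)
    (by norm_num) hinner 13 (by norm_num)

/-- `c = 1 − 625/(2·26²) = 727/1352` (the thin shell `[5/4, 1.30]`): at most `14`. -/
theorem card_le_14_of_inner_le {ι : Type*} (s : Finset ι) (u : ι → EuclideanSpace ℝ (Fin 3)) (hu : ∀ i ∈ s, ‖u i‖ = 1)
    (hinner : ∀ i ∈ s, ∀ j ∈ s, i ≠ j → inner ℝ (u i) (u j) ≤ (727 / 1352)) : s.card ≤ 14 :=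
  card_le_of_inner_le s u hu (c := (727 / 1352)) (a := (-4227 / 5000)) (b := (-1209 / 5000)) (by norm_num)
    (by norm_num) (by norm_num) (by norm_num) (by norm_num)
    (by norm_num) hinner 14 (by norm_num)

/-- `c = 1 − 625/(2·27²) = 833/1458` (the thin shell `[5/4, 1.35]`): at most `15`. -/
theorem card_le_15_of_inner_le {ι : Type*} (s : Finset ι) (u : ι → EuclideanSpace ℝ (Fin 3)) (hu : ∀ i ∈ s, ‖u i‖ = 1)
    (hinner : ∀ i ∈ s, ∀ j ∈ s, i ≠ j → inner ℝ (u i) (u j) ≤ (833 / 1458)) : s.card ≤ 15 :=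
  card_le_of_inner_le s u hu (c := (833 / 1458)) (a := (-1031 / 1250)) (b := (-467 / 2500)) (by norm_num)
    (by norm_num) (by norm_num) (by norm_num) (by norm_num)
    (by norm_num) hinner 15 (by norm_num)

/-- `c = 1 − 625/(2·28²) = 943/1568` (the thin shell `[5/4, 1.40]`): at most `17`. -/
theorem card_le_17_of_inner_le {ι : Type*} (s : Finset ι) (u : ι → EuclideanSpace ℝ (Fin 3)) (hu : ∀ i ∈ s, ‖u i‖ = 1)
    (hinner : ∀ i ∈ s, ∀ j ∈ s, i ≠ j → inner ℝ (u i) (u j) ≤ (943 / 1568)) : s.card ≤ 17 :=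
  card_le_of_inner_le s u hu (c := (943 / 1568)) (a := (-4059 / 5000)) (b := (-73 / 500)) (by norm_num)
    (by norm_num) (by norm_num) (by norm_num) (by norm_num)
    (by norm_num) hinner 17 (by norm_num)

/-- `c = 1 − 625/(2·29²) = 1057/1682` (the thin shell `[5/4, 1.45]`): at most `19`. -/
theorem card_le_19_of_inner_le {ι : Type*} (s : Finset ι) (u : ι → EuclideanSpace ℝ (Fin 3)) (hu : ∀ i ∈ s, ‖u i‖ = 1)
    (hinner : ∀ i ∈ s, ∀ j ∈ s, i ≠ j → inner ℝ (u i) (u j) ≤ (1057 / 1682)) : s.card ≤ 19 :=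
  card_le_of_inner_le s u hu (c := (1057 / 1682)) (a := (-2007 / 2500)) (b := (-573 / 5000)) (by norm_num)
    (by norm_num) (by norm_num) (by norm_num) (by norm_num)
    (by norm_num) hinner 19 (by norm_num)

/-- `c = 1 − 625/(2·30²) = 47/72` (the thin shell `[5/4, 1.50]`): at most `21`. -/
theorem card_le_21_of_inner_le {ι : Type*} (s : Finset ι) (u : ι → EuclideanSpace ℝ (Fin 3)) (hu : ∀ i ∈ s, ‖u i‖ = 1)
    (hinner : ∀ i ∈ s, ∀ j ∈ s, i ≠ j → inner ℝ (u i) (u j) ≤ (47 / 72)) : s.card ≤ 21 :=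
  card_le_of_inner_le s u hu (c := (47 / 72)) (a := (-199 / 250)) (b := (-56 / 625)) (by norm_num)
    (by norm_num) (by norm_num) (by norm_num) (by norm_num)
    (by norm_num) hinner 21 (by norm_num)

/-- `c = 1 − 625/(2·31²) = 1297/1922` (the thin shell `[5/4, 1.55]`): at most `25`. -/
theorem card_le_25_of_inner_le {ι : Type*} (s : Finset ι) (u : ι → EuclideanSpace ℝ (Fin 3)) (hu : ∀ i ∈ s, ‖u i‖ = 1)
    (hinner : ∀ i ∈ s, ∀ j ∈ s, i ≠ j → inner ℝ (u i) (u j) ≤ (1297 / 1922)) : s.card ≤ 25 :=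
  card_le_of_inner_le s u hu (c := (1297 / 1922)) (a := (-791 / 1000)) (b := (-87 / 1250)) (by norm_num)
    (by norm_num) (by norm_num) (by norm_num) (by norm_num)
    (by norm_num) hinner 25 (by norm_num)

/-- `c = 1 − 625/(2·32²) = 1423/2048` (the thin shell `[5/4, 1.60]`): at most `29`. -/
theorem card_le_29_of_inner_le {ι : Type*} (s : Finset ι) (u : ι → EuclideanSpace ℝ (Fin 3)) (hu : ∀ i ∈ s, ‖u i‖ = 1)
    (hinner : ∀ i ∈ s, ∀ j ∈ s, i ≠ j → inner ℝ (u i) (u j) ≤ (1423 / 2048)) : s.card ≤ 29 :=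
  card_le_of_inner_le s u hu (c := (1423 / 2048)) (a := (-787 / 1000)) (b := (-133 / 2500)) (by norm_num)
    (by norm_num) (by norm_num) (by norm_num) (by norm_num)
    (by norm_num) hinner 29 (by norm_num)

/-- `c = 1 − 625/(2·33²) = 1553/2178` (the thin shell `[5/4, 1.65]`): at most `36`. -/
theorem card_le_36_of_inner_le {ι : Type*} (s : Finset ι) (u : ι → EuclideanSpace ℝ (Fin 3)) (hu : ∀ i ∈ s, ‖u i‖ = 1)
    (hinner : ∀ i ∈ s, ∀ j ∈ s, i ≠ j → inner ℝ (u i) (u j) ≤ (1553 / 2178)) : s.card ≤ 36 :=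
  card_le_of_inner_le s u hu (c := (1553 / 2178)) (a := (-1959 / 2500)) (b := (-197 / 5000)) (by norm_num)
    (by norm_num) (by norm_num) (by norm_num) (by norm_num)
    (by norm_num) hinner 36 (by norm_num)

/-- `c = 1 − 625/(2·34²) = 1687/2312` (the thin shell `[5/4, 1.70]`): at most `46`. -/
theorem card_le_46_of_inner_le {ι : Type*} (s : Finset ι) (u : ι → EuclideanSpace ℝ (Fin 3)) (hu : ∀ i ∈ s, ‖u i‖ = 1)
    (hinner : ∀ i ∈ s, ∀ j ∈ s, i ≠ j → inner ℝ (u i) (u j) ≤ (1687 / 2312)) : s.card ≤ 46 :=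
  card_le_of_inner_le s u hu (c := (1687 / 2312)) (a := (-781 / 1000)) (b := (-139 / 5000)) (by norm_num)
    (by norm_num) (by norm_num) (by norm_num) (by norm_num)
    (by norm_num) hinner 46 (by norm_num)

end Summit.AtomisticToContinuum.Crystallization.Theorems.StrictSplittingRuleBirth

end
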